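import Summits.BirchSwinnertonDyer.BirchSwinnertonDyer.Theses.EdixhovenFibreFiveSeven
import Summits.BirchSwinnertonDyer.BirchSwinnertonDyer.Theorems.AdditiveKolyvaginRoadManinFrameResidueProperRTameTwistFull57
import Summits.BirchSwinnertonDyer.Rank1Residual.Additive.GordTorsionFiveSeven
import HarnessLib

/-!
# Route `EdixhovenFibreFiveSeven`, crux K★ `StarredOptimalManinUnitFiveSeven` (stmt-BirchSwinnertonDyer-22226):
# Manin's `p`-part at the `X₀(N)`-optimal curve of STARRED additive type at `p ∈ {5, 7}` — from Kato's integral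
# zeta elements in Néron units (the tame-twist lever), GRANTED ONE cite-only Literature fact (F″)

Cell `pub/bsd-wall`, seat `bsd-line-edix-p1` g0 (line `kato-lever`, skeleton
`Cruxes/StarredOptimalManinUnitFiveSeven/Lines/kato_lever.lean`). The route card planned to attack K★ through
Edixhoven's stable fibre of `X₀(p²M)` at `p = 5, 7` (Edixhoven 1991 Thm. 3 is printed for `p > 7` only: the
typescript says "for a number of reasons, we suppose that p > 7", and Prop. 7 needs the semistability defect
`d < p − 1`). THIS FILE AVOIDS THE STABLE FIBRE ALTOGETHER: K★ is a corollary of the `p ∈ {5, 7}` tame-twist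
lever of crux `ManinFrameResidueProperR` (seats bsd-wall-manin-p1 g3/g4;
`ManinFrameResidueProperRTameTwist.not_dvd_c_of_tameTwist57`, p579959: at an additive `p ∈ {5, 7}` with `E[p]`
irreducible and NO `ℚ_p`-rational point of order `p`, every lattice-optimal datum at a level `N` with `p² ∣ N` and
`a_ℓ = ±1` at `ℓ ∥ N` has `p ∤ c`, GRANTED the statement-only Literature fact
F″ = `kato_neron_isIntegral_twistedSymbolSum_of_additive_five_le` (Kato 2004 (8.1.3)/Thm 9.7/Thm 6.6(1) +
Kim–Nakamura 2020 §2 ⟸ Kosters–Pannekoek 2017 Thm 1, off the exceptional case)), because on the STARRED locus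
`4 < v_p(Δ_min)` the Kosters–Pannekoek exception cannot occur: a point of order `p` in `E(ℚ_p)` at an additive
`p ≥ 5` forces `v₅(c₄) = 1` or `v₇(c₆) = 1`, hence `v_p(Δ_min) ≤ 3` — the TREE theorem
`Rank1Residual.Additive.eq_zero_of_prime_nsmul_eq_zero_of_addv_of_four_le` (Mazur 1977 III §5 Step 1 at 5, 7).

* `starredOptimalManinUnitFiveSeven_of_kato : F″ → StarredOptimalManinUnitFiveSeven` — K★ CONDITIONAL on
  exactly ONE cite-only fact (F″, p576988; audited first-hand and review-sampled, manin-p1 g4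
  MEMO-F1-audit-manin-p1-g4.md); the binder "no `Iₙ*` fibre at `p`" of K★ is not used.

HONEST STATUS: the item's own signature is NOT proved (conditional-result); it becomes a theorem of the tree when F″
is formalised (XL: Kato's explicit reciprocity law + the additive receptacle) or when the planner moves F″ into
the route's hypothesis bundle `PublishedManinFacts`. BSD is not proved by any of this.
-/

set_option autoImplicit false
-- the Theorems namespace of this sub repeats the summit name by design (D-0017 nested layout)
set_option linter.dupNamespace false

noncomputable section

open scoped Classical MatrixGroups

open WeierstrassCurve NumberField Literature.NumberTheory.EllipticCurves
  Literature.NumberTheory.EllipticCurves.ModularForms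
  Literature.NumberTheory.EllipticCurves.Rank1Residual
  Summit.BirchSwinnertonDyer.Rank1Residual Summit.BirchSwinnertonDyer.Rank1Residual.Additive

namespace Summit.BirchSwinnertonDyer.BirchSwinnertonDyer.Theorems

/-- **K★ `StarredOptimalManinUnitFiveSeven` GRANTED F″ (Kato's integral zeta elements in Néron units at an
additive `p ≥ 5`, off the Kosters–Pannekoek exception).** For `W/ℚ` globally minimal, `p ∈ {5, 7}`, additive at
`p`, `E[p]` irreducible, `4 < v_p(Δ_min)` (Kodaira IV*, III*, II*) and `D` a LATTICE-OPTIMAL conductor-level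
parametrisation datum (`Λ_W = c·Λ_f`): `p ∤ c(D)`. Proof: `W(ℚ_p)[p] = 0`
(`eq_zero_of_prime_nsmul_eq_zero_of_addv_of_four_le`, from `4 ≤ v_p Δ_min`); `p² ∣ N(W)`
(`sq_dvd_conductorNorm_of_not_good_of_not_mult`); `a_ℓ(W) = ±1` at every `ℓ ∥ N(W)` (Kraus–Oesterlé,
`lFunction_apply_prime_eq_one_or_eq_neg_one_of_mult`); then the `p ∈ {5, 7}` tame-twist lever
`ManinFrameResidueProperRTameTwist.not_dvd_c_of_tameTwist57`. [cite: Kato2004Asterisque, (8.1.3) (p. 180), Thm. 9.7 (p. 189), Thm. 6.6 (1) (p. 163)]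
[cite: KimNakamura2020, Thm. 2.1, Cor. 2.4] [cite: KostersPannekoek2017, Thm. 1 and Cor. 2]
[cite: Mazur1977, Ch. III §5, Step 1, p. 158] [cite: EdixhovenManin1991, §1 and Thm. 3] -/
theorem starredOptimalManinUnitFiveSeven_of_kato
    (hK : kato_neron_isIntegral_twistedSymbolSum_of_additive_five_le) :
    Summit.BirchSwinnertonDyer.BirchSwinnertonDyer.Theses.EdixhovenFibreFiveSeven.StarredOptimalManinUnitFiveSeven := by
  intro W _ _ p _ _ D hp57 hadd hirr _hIstar h4 hopt
  have hp5 : 5 ≤ p := by rcases hp57 with rfl | rfl <;> norm_num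
  -- no `p`-torsion in `W(ℚ_p)` on the starred locus (`4 ≤ v_p Δ_min`)
  have hPT : ∀ P : (W.baseChange ℚ_[p]).toAffine.Point, p • P = 0 → P = 0 :=
    fun P hP ↦ eq_zero_of_prime_nsmul_eq_zero_of_addv_of_four_le W p hp5 hadd (le_of_lt h4) hP
  -- `p² ∣ N(W)` (additive) and `a_ℓ = ±1` at the multiplicative primes `ℓ ∥ N(W)` (Kraus–Oesterlé)
  have hpN : p ^ 2 ∣ W.conductorNorm ℤ := sq_dvd_conductorNorm_of_not_good_of_not_mult hadd
  have ha : ∀ ℓ ∈ (W.conductorNorm ℤ).primeFactors, ¬ ℓ ^ 2 ∣ W.conductorNorm ℤ →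
      W.LFunction ℓ = 1 ∨ W.LFunction ℓ = -1 := by
    intro ℓ hℓ hℓ2
    haveI : Fact ℓ.Prime := ⟨Nat.prime_of_mem_primeFactors hℓ⟩
    rcases hasGoodReductionAtPrime_or_hasMultiplicativeReductionAtPrime_of_not_sq_dvd_conductorNorm (V := W) hℓ2
      with hg | hmul
    · exact absurd (Nat.dvd_of_mem_primeFactors hℓ) (not_dvd_conductorNorm_of_hasGoodReductionAtPrime W hg)
    · exact KrausOesterle1992.lFunction_apply_prime_eq_one_or_eq_neg_one_of_mult W ℓ hmul
  exact ManinFrameResidueProperRTameTwist.not_dvd_c_of_tameTwist57 hK hp57 W D hopt hPT hadd hirr hpN ha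

end Summit.BirchSwinnertonDyer.BirchSwinnertonDyer.Theorems

end
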